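import Summits.BirchSwinnertonDyer.BirchSwinnertonDyer.Theorems.AdditiveBranchIMCMultLowerCruxShape
import Summits.BirchSwinnertonDyer.Rank1Residual.Additive.TwistedBranchPAdicGrossZagier
import HarnessLib

/-!
# Route `AdditiveBranchIMC` (rung K1), crux `MultLower` (item `stmt-BirchSwinnertonDyer-19359`), cell (M):
# REGULATOR RIGIDITY — two (B)-height data have unit-proportional `p`-adic regulators — and the child
# `MultBranchPAdicGrossZagierAt` (item 19592) BY NAME modulo three named facts

Cell `bsd-addord`, seat `bsd-addord-k1-c4` (gen 4). Sequel of `AdditiveBranchIMCMultLowerCruxShape.lean`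
(p426893, the glue of the §C split of 19359) and of the (M) clause supplier
`Additive.branchPAdicGrossZagierMultAt_of_twisted` (gz, `TwistedBranchPAdicGrossZagier.lean`).
THEOREMS ONLY (no definition, no named fact, no `sorry`); every published input is an explicit
named-fact binder; nothing is asserted about any curve; cell (M) stays CONSTRUCTION-shaped; nothing booked.

## The point

The rank-`1` children of 19359 quantify over EVERY `p`-adic height datum `Dh` carrying Delbourgo's
Theorem (B) clauses (`Delbourgo2002.LeadingTermClauses W p Dh`): 19591 `MultSchneiderNondegeneracy`
(`Reg_p(E,Dh) ≠ 0`) and 19592 `MultBranchPAdicGrossZagierAt` (`BranchPAdicGrossZagierMultAt W p Dh`). The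
published suppliers give ONE datum: Delbourgo 2002 (M) (`∃ Dh, LeadingTermClauses`) and the cell fact
`Disegni2017.delbourgoDatum_rankOne_leadingTerms` (hFact: `∃ Dh, LeadingTermClauses ∧
TwistedBranchGrossZagierAt`, whose (M) clause IS the rank-`1` content of `BranchPAdicGrossZagierMultAt`,
`branchPAdicGrossZagierMultAt_of_twisted`). §1 closes the gap between ONE datum and EVERY datum:

* §1 **REGULATOR RIGIDITY** (`exists_unit_padicRegulator_eq_of_leadingTermClauses`): if `X(E/ℚ_∞)` is
  `Λ`-torsion (Delbourgo (A)), `Ш(E/ℚ)[p^∞]` is finite and the pair is non-anomalous (`ℓ_p = 1`; automatic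
  on (M)), then any two data `Dh₀, Dh` with `LeadingTermClauses` satisfy `Reg_p(Dh) = v · Reg_p(Dh₀)` for
  a unit `v ∈ ℤ_p^×`. Proof: instantiate both clause bundles at ONE cyclotomic dual datum `D` and ONE
  generator `fE` of `char_Λ X`; if `Reg_p(Dh₀) ≠ 0`, clause 2 gives `ord_{T=0} fE = rank`, hence
  `Reg_p(Dh) ≠ 0`, and clause 3 for both reads `[T^r]fE·log^r·#tors² = u₀·#Ш[p^∞]·Reg_p(Dh₀)·Tam =
  u·#Ш[p^∞]·Reg_p(Dh)·Tam`; if `Reg_p(Dh₀) = 0`, clause 2 forces `ord_{T=0} fE ≠ rank` and then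
  `Reg_p(Dh) = 0` too. So "for every (B)-datum" = "for one (B)-datum" on cell (M), for Schneider AND for
  the `p`-adic Gross–Zagier identity (§2: the identity transports along a unit, `…_of_unit_mul_padicRegulator`).
* §3 On `PotMult W p` (`p` odd, `r_an ≤ 1`): `BranchPAdicGrossZagierMultAt` at one (B)-datum ⟹ at every
  (B)-datum (`potMult_branchPAdicGrossZagierMultAt_of_one_datum`; (A) from `hDelM`, `Ш` finite from GZK,
  `ℓ_p = 1` from `PotMult.reductionNonAnomalous`); with hFact as the supplier,
  `potMult_forall_branchPAdicGrossZagierMultAt_of_delbourgoDatumFact` (rank `1`) and the rank-`≤ 1` form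
  (rank `0` is the tree theorem `branchPAdicGrossZagierMultAt_of_analyticRank_eq_zero`).
* §4 **ITEM 19592 BY NAME**: `multBranchPAdicGrossZagierAt_of_delbourgoDatumFact :
  hFact → Delbourgo2002.mainTheorem_potMult → GZK → MultBranchPAdicGrossZagierAt` — CONDITIONAL on three
  NAMED FACTS (all in the tree; hFact = the cell theorem PROOF-gz Thm. 1 ∘ Delbourgo (B), REF-gz PASS with
  condition GZ-H), no certificate, no image hypothesis, `p = 3` included.

HONEST LABELS: conditional helper theorems. hFact is a named fact (not a `_holds`); its (G-ord) even/odd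
clauses were re-derived in the kernel from Disegni 2017 Thm. A/B (gz, `DisegniLine*`), its (M) clauses
NOT YET (that kernel twin is this seat's next file). REFEREE CONDITION GZ-H (binding on every (M)
statement below, which cover `V` SPLIT multiplicative; verbatim in substance from
`TwistedBranchLeadingTerm.lean`): the height identification behind hFact's Gross–Zagier half on (M) ∩ {`V`
split} is the (n-exc)-CONDITIONAL printed sentence Disegni, Compos. Math. 153 (2017) Rem. 1.3.2 together
with Disegni, Invent. Math. 230 (2022) Thm. B context, with (n-exc) DISCHARGED because `ε_p` is ramified;
it is NOT Delbourgo 2002 p. 62's unconditional sentence, and Nekovář 1993 §7.14 is not held on the hub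
(acq-10827). Nothing booked.

References: Delbourgo, J. Number Theory 95 (2002) Thm. (A), (B) p. 40, `ℓ_p` p. 39 [Delbourgo2002];
Disegni, Compos. Math. 153 (2017) Thm. B, Rem. 1.3.2 [Disegni2017]; Mazur–Tate–Teitelbaum, Invent. Math.
84 (1986) §I.10, §I.13–I.14, §II.4 [MazurTateTeitelbaum1986Invent]; Schneider, Invent. Math. 79 (1985)
[Schneider1985]; Miller, LMS J. Comput. Math. 14 (2011) Def. 1.1 [Miller2011LMS].
-/

set_option autoImplicit false
set_option linter.dupNamespace false

noncomputable section

open scoped Classical MatrixGroups ModularForm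

namespace Summit.BirchSwinnertonDyer.BirchSwinnertonDyer.Theorems.AdditiveBranchIMCMultLower

open CongruenceSubgroup WeierstrassCurve Literature.NumberTheory.EllipticCurves
  Literature.NumberTheory.EllipticCurves.ModularForms
  Literature.NumberTheory.EllipticCurves.Rank1Residual
  Literature.NumberTheory.EllipticCurves.Rank1Residual.Typed
  Literature.NumberTheory.EllipticCurves.Delbourgo2002
  Literature.NumberTheory.EllipticCurves.Disegni2017
  Summit.BirchSwinnertonDyer.Rank1Residual.Additive
  Summit.BirchSwinnertonDyer.Rank1Residual.AdditivePotMult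

variable {W : WeierstrassCurve ℚ} {p : ℕ} [hp : Fact p.Prime]

/-! ### §1 Regulator rigidity: two (B)-data have unit-proportional regulators -/

omit hp in
/-- Coercion bookkeeping: for units `u, v` of `ℤ_p`, `↑(u * v⁻¹) * ↑v = ↑u` in `ℚ_p`. [folklore] -/
theorem coe_units_mul_inv_mul' [Fact p.Prime] (u v : ℤ_[p]ˣ) :
    (((u * v⁻¹ : ℤ_[p]ˣ) : ℤ_[p]) : ℚ_[p]) * ((v : ℤ_[p]) : ℚ_[p]) = ((u : ℤ_[p]) : ℚ_[p]) := by
  have h : ((u * v⁻¹ : ℤ_[p]ˣ) : ℤ_[p]) * (v : ℤ_[p]) = (u : ℤ_[p]) := by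
    rw [← Units.val_mul, inv_mul_cancel_right]
  rw [← PadicInt.coe_mul, h]

/-- **REGULATOR RIGIDITY.** Let `W/ℚ` be globally minimal and `p` a prime such that (A) the Pontryagin
dual of `Sel_{p^∞}(E/ℚ_∞)` is `Λ`-torsion for every dual datum of the cyclotomic `ℤ_p`-extension,
`Ш(E/ℚ)[p^∞]` is finite, and the pair is non-anomalous in Delbourgo's sense (`ℓ_p(E) = 1`). If two
`p`-adic height data `Dh₀`, `Dh` on `E(ℚ)` BOTH satisfy Delbourgo's Theorem (B) clauses
(`LeadingTermClauses`), then `Reg_p(E,Dh) = v · Reg_p(E,Dh₀)` for some `v ∈ ℤ_p^×`. (Both clause bundles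
are read at one cyclotomic dual datum and one generator `fE` of `char_Λ X(E/ℚ_∞)`: clause 2 makes
`Reg_p ≠ 0` a property of `fE` — `ord_{T=0} fE = rank E(ℚ)` — hence shared; clause 3 then pins both
regulators to the same leading coefficient up to units; if instead `Reg_p(Dh₀) = 0` both vanish.)
[cite: Delbourgo2002, Theorem (B) (p. 40), ℓ_p(E) (p. 39)] [cite: MazurTateTeitelbaum1986Invent, §II.4] -/
theorem exists_unit_padicRegulator_eq_of_leadingTermClauses [W.IsElliptic]
    (hA : ∀ (κ : ZpExtension ℚ p) (γ : Field.absoluteGaloisGroup ℚ),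
      κ.IsCyclotomic → κ.IsTopGenerator γ → ∀ D : W.SelmerDualData κ γ, D.IsTorsion)
    (hfin : Finite (AddCommGroup.primaryComponent W.sha p)) (hna : ReductionNonAnomalous W p)
    {Dh₀ Dh : PAdicHeightData W p} (hB₀ : LeadingTermClauses W p Dh₀) (hB : LeadingTermClauses W p Dh) :
    ∃ v : ℤ_[p]ˣ, padicRegulator Dh = ((v : ℤ_[p]) : ℚ_[p]) * padicRegulator Dh₀ := by
  obtain ⟨κ, hκ, γ, hγ, hγ'⟩ := exists_isCyclotomic_isTopGenerator_isCyclotomicVariable_holds p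
  obtain ⟨D⟩ := W.nonempty_selmerDualData_holds κ γ hγ
  haveI : Module.Finite (IwasawaAlgebra p) D.X := D.module_finite_holds hγ
  obtain ⟨fE, hchar, -⟩ := exists_charIdeal_eq_span_singleton p D
  have hXt : D.IsTorsion := hA κ γ hκ hγ D
  obtain ⟨-, hiff₀, -⟩ := hB₀ κ γ hκ hγ hγ' D hXt fE hchar
  obtain ⟨-, hiff, -⟩ := hB κ γ hκ hγ hγ' D hXt fE hchar
  by_cases hS₀ : SchneiderConjecture Dh₀
  · -- `ord_{T=0} fE = rank`, so `Reg_p(Dh) ≠ 0` as well, and clause 3 pins both regulators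
    have hord : fE.order = W.mordellWeilRank := hiff₀.mpr ⟨hS₀, hfin⟩
    have hS : SchneiderConjecture Dh := (hiff.mp hord).1
    obtain ⟨u₀, h₀⟩ := hB₀.leadingCoeff_of_nonAnomalous hκ hγ hγ' D hXt hchar hS₀ hfin hna
    obtain ⟨u, h⟩ := hB.leadingCoeff_of_nonAnomalous hκ hγ hγ' D hXt hchar hS hfin hna
    haveI : Nonempty (AddCommGroup.primaryComponent W.sha p) := ⟨0⟩
    have hS0 : (Nat.card (AddCommGroup.primaryComponent W.sha p) : ℚ_[p]) ≠ 0 := by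
      exact_mod_cast (Nat.card_pos (α := AddCommGroup.primaryComponent W.sha p)).ne'
    have hT : (W.tamagawaProduct : ℚ_[p]) ≠ 0 := by
      exact_mod_cast (W.tamagawaProduct_pos_holds : 0 < W.tamagawaProduct).ne'
    have hu : ((u : ℤ_[p]) : ℚ_[p]) ≠ 0 := PadicInt.coe_ne_zero.mpr u.ne_zero
    refine ⟨u₀ * u⁻¹, ?_⟩
    have key := coe_units_mul_inv_mul' u₀ u
    -- `u·(S·Reg·T) = u₀·(S·Reg₀·T)`
    have h1 : ((u : ℤ_[p]) : ℚ_[p]) *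
        ((Nat.card (AddCommGroup.primaryComponent W.sha p) : ℚ_[p]) * padicRegulator Dh *
          W.tamagawaProduct) =
        ((u₀ : ℤ_[p]) : ℚ_[p]) *
        ((Nat.card (AddCommGroup.primaryComponent W.sha p) : ℚ_[p]) * padicRegulator Dh₀ *
          W.tamagawaProduct) := by rw [← h, ← h₀]
    have h2 : ((u : ℤ_[p]) : ℚ_[p]) * padicRegulator Dh = ((u₀ : ℤ_[p]) : ℚ_[p]) * padicRegulator Dh₀ := by
      have h3 := h1
      apply mul_left_cancel₀ (mul_ne_zero hS0 hT)
      linear_combination h3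
    apply mul_left_cancel₀ hu
    rw [h2, ← key]
    ring
  · -- `Reg_p(Dh₀) = 0`: then `ord_{T=0} fE ≠ rank`, so `Reg_p(Dh) = 0` too
    have hR₀ : padicRegulator Dh₀ = 0 := by
      by_contra h
      exact hS₀ h
    have hS : ¬ SchneiderConjecture Dh := fun hS ↦ hS₀ (hiff₀.mp (hiff.mpr ⟨hS, hfin⟩)).1
    have hR : padicRegulator Dh = 0 := by
      by_contra h
      exact hS h
    exact ⟨1, by rw [hR, hR₀, mul_zero]⟩

/-- **Schneider transports between (B)-data** (corollary of rigidity): under the same hypotheses, if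
`Reg_p(E,Dh₀) ≠ 0` for ONE datum with Delbourgo's clauses then `Reg_p(E,Dh) ≠ 0` for EVERY such datum.
[cite: Delbourgo2002, Theorem (B) (p. 40)] [cite: Schneider1985, Thm. 2′ (shape; nothing asserted)] -/
theorem schneiderConjecture_of_leadingTermClauses_of_one_datum [W.IsElliptic]
    (hA : ∀ (κ : ZpExtension ℚ p) (γ : Field.absoluteGaloisGroup ℚ),
      κ.IsCyclotomic → κ.IsTopGenerator γ → ∀ D : W.SelmerDualData κ γ, D.IsTorsion)
    (hfin : Finite (AddCommGroup.primaryComponent W.sha p)) (hna : ReductionNonAnomalous W p)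
    {Dh₀ Dh : PAdicHeightData W p} (hB₀ : LeadingTermClauses W p Dh₀) (hB : LeadingTermClauses W p Dh)
    (hS₀ : SchneiderConjecture Dh₀) : SchneiderConjecture Dh := by
  obtain ⟨v, hv⟩ := exists_unit_padicRegulator_eq_of_leadingTermClauses hA hfin hna hB₀ hB
  rw [SchneiderConjecture, hv]
  exact mul_ne_zero (PadicInt.coe_ne_zero.mpr v.ne_zero) hS₀

/-! ### §2 The one-term mult-branch `p`-adic Gross–Zagier identity transports along a unit -/

/-- **`BranchPAdicGrossZagierMultAt` transports along a unit rescaling of the regulator**: if the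
identity `ϖ·[T^r]B·log_p(γ)^r = u·q·Reg_p(E,Dh₀)` holds at `Dh₀` (for every admissible `(V, f, B, ϖ)`)
and `Reg_p(E,Dh₀) = v·Reg_p(E,Dh)` with `v ∈ ℤ_p^×`, it holds at `Dh` with the unit `u·v`.
[cite: MazurTateTeitelbaum1986Invent, §I.13–I.14, §II.4 (shape of the identity)] -/
theorem branchPAdicGrossZagierMultAt_of_unit_mul_padicRegulator [W.IsElliptic] {Dh₀ Dh : PAdicHeightData W p}
    (h₀ : BranchPAdicGrossZagierMultAt W p Dh₀) {v : ℤ_[p]ˣ}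
    (hv : padicRegulator Dh₀ = ((v : ℤ_[p]) : ℚ_[p]) * padicRegulator Dh) :
    BranchPAdicGrossZagierMultAt W p Dh := by
  intro V _ _ N _ f B hp2 hVW hVB hf ϖ hϖ
  obtain ⟨u, q, hlead, hid⟩ := h₀ V B hp2 hVW hVB hf ϖ hϖ
  refine ⟨u * v, q, hlead, ?_⟩
  rw [hid, hv, Units.val_mul, PadicInt.coe_mul]
  ring

/-! ### §3 Cell (M): from ONE (B)-datum to EVERY (B)-datum -/

/-- **(M), `r_an ≤ 1`: the typed (M) `p`-adic Gross–Zagier at ONE (B)-datum gives it at EVERY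
(B)-datum.** For `W` globally minimal, `p` odd, `PotMult W p`: (A)-torsion from Delbourgo 2002 (M)
(`hDelM`), `Ш` finite from GZK (`r_an ≤ 1`), `ℓ_p = 1` (`PotMult.reductionNonAnomalous`) — so §1 applies.
[cite: Delbourgo2002, Theorem (A), (B) (p. 40), ℓ_p(E) = 1 (p. 39)] [cite: MazurTateTeitelbaum1986Invent, §I.13–I.14] -/
theorem potMult_branchPAdicGrossZagierMultAt_of_one_datum [W.IsElliptic] [W.IsGloballyMinimal]
    (hDelM : Delbourgo2002.mainTheorem_potMult) (hGZK : rank_eq_analyticRank_of_analyticRank_le_one)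
    (hpm : Summit.BirchSwinnertonDyer.Rank1Residual.AdditivePotMult.PotMult W p) (hp2 : p ≠ 2) (hr : W.analyticRank ≤ 1)
    {Dh₀ : PAdicHeightData W p} (hB₀ : LeadingTermClauses W p Dh₀)
    (hGZ₀ : BranchPAdicGrossZagierMultAt W p Dh₀)
    {Dh : PAdicHeightData W p} (hB : LeadingTermClauses W p Dh) :
    BranchPAdicGrossZagierMultAt W p Dh := by
  haveI : Finite W.sha := (hGZK W hr).2
  have hfin : Finite (AddCommGroup.primaryComponent W.sha p) := inferInstance
  obtain ⟨v, hv⟩ := exists_unit_padicRegulator_eq_of_leadingTermClauses (hpm.delbourgo2002 hDelM hp2).1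
    hfin hpm.reductionNonAnomalous hB hB₀
  exact branchPAdicGrossZagierMultAt_of_unit_mul_padicRegulator hGZ₀ hv

/-- **(M), `r_an = 1`: hFact supplies ONE (B)-datum with the typed (M) `p`-adic Gross–Zagier.** For `W`
globally minimal, `p` odd, `PotMult W p` (so: additive at `p`, `ord_p j < 0`, NO CM —
`PotMult.not_hasCM`, Delbourgo's printed (M) hypothesis — `delbourgo2002PrintedHypotheses_of_potMult`),
`r_an = 1`: hFact `Disegni2017.delbourgoDatum_rankOne_leadingTerms` gives `Dh` with
`LeadingTermClauses W p Dh ∧ TwistedBranchGrossZagierAt W p Dh`, and the latter's (M) clause is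
`BranchPAdicGrossZagierMultAt W p Dh` (`branchPAdicGrossZagierMultAt_of_twisted`, GZK for `rank = 1`).
GZ-H applies (module docstring). [cite: Disegni2017, Thm. B (§1.3.2), Rem. 1.3.2]
[cite: Delbourgo2002, Theorem (B) (p. 40), Hypothesis (p. 39)] -/
theorem potMult_exists_leadingTermClauses_and_branchPAdicGrossZagierMultAt_of_delbourgoDatumFact
    [W.IsElliptic] [W.IsGloballyMinimal]
    (hFact : delbourgoDatum_rankOne_leadingTerms) (hGZK : rank_eq_analyticRank_of_analyticRank_le_one)
    (hpm : Summit.BirchSwinnertonDyer.Rank1Residual.AdditivePotMult.PotMult W p) (hp2 : p ≠ 2) (hr : W.analyticRank = 1) :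
    ∃ Dh : PAdicHeightData W p, LeadingTermClauses W p Dh ∧ BranchPAdicGrossZagierMultAt W p Dh := by
  obtain ⟨Dh, hB, hTw⟩ := hFact W p hp2 hpm.not_hasCM hpm.1 hr
    (delbourgo2002PrintedHypotheses_of_potMult hpm.2 (hpm.exists_quadraticTwist_mult hp2))
  exact ⟨Dh, hB, branchPAdicGrossZagierMultAt_of_twisted hGZK hr hTw⟩

/-- **(M), `r_an = 1`: the typed (M) `p`-adic Gross–Zagier for EVERY (B)-datum, from hFact + Delbourgo
2002 (M) + GZK** (one datum from hFact, every datum by rigidity). No certificate, no image hypothesis,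
`p = 3` included; GZ-H applies. [cite: Disegni2017, Thm. B (§1.3.2), Rem. 1.3.2]
[cite: Delbourgo2002, Theorem (A), (B) (p. 40)] -/
theorem potMult_forall_branchPAdicGrossZagierMultAt_of_delbourgoDatumFact
    [W.IsElliptic] [W.IsGloballyMinimal]
    (hFact : delbourgoDatum_rankOne_leadingTerms) (hDelM : Delbourgo2002.mainTheorem_potMult)
    (hGZK : rank_eq_analyticRank_of_analyticRank_le_one)
    (hpm : Summit.BirchSwinnertonDyer.Rank1Residual.AdditivePotMult.PotMult W p) (hp2 : p ≠ 2) (hr : W.analyticRank = 1)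
    (Dh : PAdicHeightData W p) (hB : LeadingTermClauses W p Dh) :
    BranchPAdicGrossZagierMultAt W p Dh := by
  obtain ⟨Dh₀, hB₀, hGZ₀⟩ :=
    potMult_exists_leadingTermClauses_and_branchPAdicGrossZagierMultAt_of_delbourgoDatumFact hFact hGZK hpm
      hp2 hr
  exact potMult_branchPAdicGrossZagierMultAt_of_one_datum hDelM hGZK hpm hp2 (by rw [hr]) hB₀ hGZ₀ hB

/-- **(M), `r_an ≤ 1`: the typed (M) `p`-adic Gross–Zagier for EVERY height datum with Delbourgo's
clauses** — rank `0` is the tree THEOREM `branchPAdicGrossZagierMultAt_of_analyticRank_eq_zero` (Birch +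
MTT one-term constant terms, modularity `hmod`; no height, no hFact), rank `1` is the previous theorem.
[cite: MazurTateTeitelbaum1986Invent, §I.8, §I.10, §I.13–I.14] [cite: Disegni2017, Thm. B (§1.3.2)]
[cite: Delbourgo2002, Theorem (A), (B) (p. 40)] -/
theorem potMult_forall_branchPAdicGrossZagierMultAt_rankLeOne_of_delbourgoDatumFact
    [W.IsElliptic] [W.IsGloballyMinimal]
    (hFact : delbourgoDatum_rankOne_leadingTerms) (hDelM : Delbourgo2002.mainTheorem_potMult)
    (hmod : hasEntireLFunction_rat) (hGZK : rank_eq_analyticRank_of_analyticRank_le_one)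
    (hpm : Summit.BirchSwinnertonDyer.Rank1Residual.AdditivePotMult.PotMult W p) (hp2 : p ≠ 2) (hr : W.analyticRank ≤ 1)
    (Dh : PAdicHeightData W p) (hB : LeadingTermClauses W p Dh) :
    BranchPAdicGrossZagierMultAt W p Dh := by
  rcases Nat.le_one_iff_eq_zero_or_eq_one.mp hr with h0 | h1
  · exact branchPAdicGrossZagierMultAt_of_analyticRank_eq_zero W p hmod hGZK hpm.1 h0 Dh
  · exact potMult_forall_branchPAdicGrossZagierMultAt_of_delbourgoDatumFact hFact hDelM hGZK hpm hp2 h1 Dh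
      hB

/-! ### §4 ITEM 19592 `MultBranchPAdicGrossZagierAt` BY NAME, modulo three named facts -/

/-- **ITEM 19592 `MultBranchPAdicGrossZagierAt` BY NAME, CONDITIONAL on three NAMED FACTS** — hFact
`Disegni2017.delbourgoDatum_rankOne_leadingTerms` (PROOF-gz Thm. 1 ∘ Delbourgo 2002 (B): Disegni 2017
Thm. A/B + Yuan–Zhang–Zhang + MTT + Pal; REF-gz PASS with GZ-H), `Delbourgo2002.mainTheorem_potMult`
((A)-torsion on (M)) and Gross–Zagier–Kolyvagin (`rank = r_an`, `Ш` finite): for every pair `(E, p)` of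
cell (M) (`N10.CellM`: odd additive potentially multiplicative `p`) of analytic rank `1` and EVERY height
datum `Dh` with Delbourgo's clauses, `BranchPAdicGrossZagierMultAt W p Dh`. One datum from hFact
(`branchPAdicGrossZagierMultAt_of_twisted`), every datum by REGULATOR RIGIDITY (§1). No certificate, no
image / surjectivity hypothesis, `p = 3` included. GZ-H applies (module docstring). Conditional; nothing
booked. [cite: Disegni2017, Thm. B (§1.3.2), Rem. 1.3.2] [cite: Delbourgo2002, Theorem (A), (B) (p. 40), Hypothesis (p. 39)]
[cite: MazurTateTeitelbaum1986Invent, §I.10, §I.13–I.14] -/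
theorem multBranchPAdicGrossZagierAt_of_delbourgoDatumFact
    (hFact : delbourgoDatum_rankOne_leadingTerms) (hDelM : Delbourgo2002.mainTheorem_potMult)
    (hGZK : rank_eq_analyticRank_of_analyticRank_le_one) :
    Summit.BirchSwinnertonDyer.BirchSwinnertonDyer.Theses.AdditiveBranchIMC.MultBranchPAdicGrossZagierAt := by
  intro W _ _ p _ hcM hr Dh hB
  have hpm : Summit.BirchSwinnertonDyer.Rank1Residual.AdditivePotMult.PotMult W p := ⟨hcM.2.1, hcM.2.2⟩
  exact potMult_forall_branchPAdicGrossZagierMultAt_of_delbourgoDatumFact hFact hDelM hGZK hpm hcM.1 hr Dh hB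

end Summit.BirchSwinnertonDyer.BirchSwinnertonDyer.Theorems.AdditiveBranchIMCMultLower

end
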